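import Summits.RiemannHypothesis.RiemannHypothesis.Theorems.PfPersistenceRatioDegenerateWindow
import Summits.RiemannHypothesis.RiemannHypothesis.Theorems.PfPersistenceGalerkinNesting
import Summits.RiemannHypothesis.RiemannHypothesis.Theorems.PfPersistenceF6NestedWindows
import Summits.RiemannHypothesis.RiemannHypothesis.Theorems.PfPersistenceSaturatedDomains
import HarnessLib

/-!
# PF persistence — DIMENSION-ONE WINDOWS (`N = 0`): the WELL-POSEDNESS AUDIT of the typer's own classes
(cell `pub-rhpf`, barrier-typer gen 11; RULING A324 aftermath — the junk defect found in the barrier-prover's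
∀-window ratio classes, `PfPersistenceRatioDegenerateWindow`, is here run over the TYPER's gap-class file
`PfPersistenceGapClassG1` §7 and over the cell's existence table)

long-odds MECHANISM SEARCH; no RH claims.  Everything below is PROVED (Mathlib + tree theorems; no `sorry`, no
named fact used as a hypothesis, no numerical datum); nothing here bears on the truth of RH.

`Window := ⟨a, N, 0 < a⟩` admits `N = 0`.  There the block is `1 × 1` with entry `m = d ⟨a, 0⟩ 0 0`, `ε₁ = m` and
`ε₂ = max(m, 0)` (`bottomRayleigh_fin_one`, `secondRayleigh_fin_one`; the `u ≠ 0` branch of the Courant–Fischer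
supremum is the junk `sInf ∅ = 0`), so the BOTTOM-GAP GAUGE is `γ(a, 0) = max(−m, 0)` (§1).

* §1 (PROVED) the gauge at a degenerate window: `bottomGapGauge d ⟨a, 0⟩ = max (−m) 0`; `= 0 ↔ 0 ≤ m`;
  `0 < γ ↔ m < 0`; the gauge is `≥ 0` at EVERY window (degenerate ones included).
* §2 (PROVED) THE RECORDED DEFECT of `PfPersistenceGapClassG1` §7: the floor hypothesis
  `∃ g > 0, ∀ win, g ≤ bottomGapGauge d win` of `UniformlyRobustRelAt.uniformlyRobustAt` forces EVERY degenerate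
  entry `m(a) < 0` (`entry_neg_of_gauge_floor`), so it is refuted by one non-negative degenerate entry, by
  all-window positivity, and — RH-FREE, via Yoshida's short windows `a ≤ (log 2)/2`
  (`weilPositivityOn_of_le_log_two_half`) and GAL-0 — AT `ζ` (`zeta_not_exists_gauge_floor`); worse, the
  docstring's `τ_rel` DOOR "`inf_win γ(win) = 0`" is realised TRIVIALLY: `⨅ win, bottomGapGauge ζ win = 0`
  RH-free (`zeta_iInf_bottomGapGauge_eq_zero`), by a degenerate short window and not by PF-N2; and the unguarded
  relative tube PINS the degenerate short windows of `ζ` (`UniformlyCloseRel.pins_N0`).  THE GUARDED REPAIR: the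
  dimension-guarded gauge `win ↦ if 0 < win.N then γ win else 1` (`γ` on windows with `0 < N`, the absolute unit
  scale at `N = 0`); with it the bridge to W2 needs only a floor / ceiling on windows of dimension `≥ 2`
  (`UniformlyRobustRelAt.uniformlyRobustAt_of_pos_floor`, `UniformlyRobustAt.uniformlyRobustRelAt_guarded`,
  `uniformlyRobustRelAt_guarded_iff`), and the corrected door is `inf over windows with 0 < N of γ = 0` — for `ζ`'s
  bottom gap still DATA (PF-N2).
* §3 (PROVED) `N = 0`-SAFETY ON NESTED DATA (every `datumOf w`, i.e. all of `dialSpace ∋ ζ`): positivity,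
  detectable negativity, height floors and `τ_unif`-closeness at `(a, 0)` are IMPLIED by the same at `(a, 1)`
  (leading-principal-corner nesting, `PfPersistenceF6NestedWindows`, `PfPersistenceGalerkinNesting`), so the cell's
  existence table (`AllWindowsPositive` / `DetectablyNegative` / `HeightFlooredPositive`) and the tube topology on
  the dial space are decided on windows of dimension `≥ 2`: those rows are dimension-one SAFE as typed.
-/

set_option linter.dupNamespace false  -- the mandated namespace repeats `RiemannHypothesis`

noncomputable section

open Real Set Matrix

open Literature.NumberTheory.LFunctions

namespace Summit.RiemannHypothesis.RiemannHypothesis.Theorems.PfPersistence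

/-! ## §1 The bottom-gap gauge at a degenerate window -/

/-- PROVED: on a `1 × 1` window the bottom gap `ε₂ − ε₁` is `max(−m, 0)`. [folklore] -/
theorem gauge_fin_one (M : Matrix (Fin 1) (Fin 1) ℝ) :
    secondRayleigh M - bottomRayleigh M = max (-(M 0 0)) 0 := by
  rw [secondRayleigh_fin_one, bottomRayleigh_fin_one]
  rcases le_total (M 0 0) 0 with h | h
  · rw [max_eq_right h, max_eq_left (neg_nonneg.2 h), zero_sub]
  · rw [max_eq_left h, max_eq_right (neg_nonpos.2 h), sub_self]

/-- PROVED: the `1 × 1` bottom gap is non-negative. [folklore] -/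
theorem gauge_fin_one_nonneg (M : Matrix (Fin 1) (Fin 1) ℝ) : 0 ≤ secondRayleigh M - bottomRayleigh M := by
  rw [gauge_fin_one]
  exact le_max_right _ _

/-- PROVED: the `1 × 1` bottom gap VANISHES iff the entry is non-negative. [folklore] -/
theorem gauge_fin_one_eq_zero_iff (M : Matrix (Fin 1) (Fin 1) ℝ) :
    secondRayleigh M - bottomRayleigh M = 0 ↔ 0 ≤ M 0 0 := by
  rw [gauge_fin_one, max_eq_right_iff, neg_nonpos]

/-- PROVED: the `1 × 1` bottom gap is POSITIVE iff the entry is negative. [folklore] -/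
theorem gauge_fin_one_pos_iff (M : Matrix (Fin 1) (Fin 1) ℝ) :
    0 < secondRayleigh M - bottomRayleigh M ↔ M 0 0 < 0 := by
  rw [gauge_fin_one, lt_max_iff, lt_self_iff_false, or_false, neg_pos]

/-- PROVED: a `1 × 1` window is positive iff its entry is non-negative. [folklore] -/
theorem windowPositive_fin_one_iff (M : Matrix (Fin 1) (Fin 1) ℝ) : WindowPositive M ↔ 0 ≤ M 0 0 := by
  constructor
  · intro h
    have h1 := h fun _ => 1
    rw [form_fin_one] at h1
    simpa using h1
  · intro h v
    rw [form_fin_one]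
    exact mul_nonneg h (mul_self_nonneg (v 0))

/-- PROVED: two `1 × 1` matrices whose difference has identically vanishing form are equal. [folklore] -/
theorem fin_one_eq_of_form_sub_eq_zero {M M' : Matrix (Fin 1) (Fin 1) ℝ}
    (h : ∀ v : Fin 1 → ℝ, v ⬝ᵥ ((M - M') *ᵥ v) = 0) : M' = M := by
  have h1 := h fun _ => 1
  rw [form_fin_one] at h1
  have h2 : (M - M') 0 0 = 0 := by simpa using h1
  rw [Matrix.sub_apply, sub_eq_zero] at h2
  ext i j
  rw [Fin.fin_one_eq_zero i, Fin.fin_one_eq_zero j, h2]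

/-- **PROVED — THE GAUGE AT A DEGENERATE WINDOW: `bottomGapGauge d ⟨a, 0⟩ = max (−m) 0`, `m = d ⟨a, 0⟩ 0 0`.**
[folklore] -/
theorem bottomGapGauge_N0 (d : Datum) (a : ℝ) (ha : 0 < a) :
    bottomGapGauge d ⟨a, 0, ha⟩ = max (-(d ⟨a, 0, ha⟩ 0 0)) 0 :=
  gauge_fin_one (d ⟨a, 0, ha⟩)

/-- PROVED: the gauge at a degenerate window vanishes iff the entry is non-negative. [folklore] -/
theorem bottomGapGauge_N0_eq_zero_iff (d : Datum) (a : ℝ) (ha : 0 < a) :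
    bottomGapGauge d ⟨a, 0, ha⟩ = 0 ↔ 0 ≤ d ⟨a, 0, ha⟩ 0 0 :=
  gauge_fin_one_eq_zero_iff (d ⟨a, 0, ha⟩)

/-- PROVED: the gauge at a degenerate window is positive iff the entry is negative. [folklore] -/
theorem bottomGapGauge_N0_pos_iff (d : Datum) (a : ℝ) (ha : 0 < a) :
    0 < bottomGapGauge d ⟨a, 0, ha⟩ ↔ d ⟨a, 0, ha⟩ 0 0 < 0 :=
  gauge_fin_one_pos_iff (d ⟨a, 0, ha⟩)

/-- PROVED: the bottom-gap gauge is non-negative at EVERY window, degenerate ones included (complements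
`bottomGapGauge_nonneg`, which asks `0 < N`). [folklore] -/
theorem bottomGapGauge_nonneg' (d : Datum) (win : Window) : 0 ≤ bottomGapGauge d win := by
  obtain ⟨a, N, ha⟩ := win
  cases N with
  | zero => exact gauge_fin_one_nonneg (d ⟨a, 0, ha⟩)
  | succ n => exact bottomGapGauge_nonneg d ⟨a, n + 1, ha⟩ (Nat.succ_pos n)

/-! ## §2 The unsatisfiable floor of `PfPersistenceGapClassG1` §7, the trivial door, and the guarded repair -/

/-- **PROVED — THE RECORDED DEFECT: a positive floor under the bottom-gap gauge over ALL windows forces every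
degenerate entry negative**, `d ⟨a, 0⟩ 0 0 < 0` for all `a > 0`. [folklore] -/
theorem entry_neg_of_gauge_floor {d : Datum} {g : ℝ} (hg0 : 0 < g) (hg : ∀ win, g ≤ bottomGapGauge d win)
    (a : ℝ) (ha : 0 < a) : d ⟨a, 0, ha⟩ 0 0 < 0 :=
  (gauge_fin_one_pos_iff (d ⟨a, 0, ha⟩)).1 (hg0.trans_le (hg ⟨a, 0, ha⟩))

/-- PROVED: ONE non-negative degenerate entry refutes the floor hypothesis of
`UniformlyRobustRelAt.uniformlyRobustAt` for the gauge `bottomGapGauge d`. [folklore] -/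
theorem not_exists_gauge_floor_of_entry_nonneg {d : Datum} {a : ℝ} {ha : 0 < a} (h : 0 ≤ d ⟨a, 0, ha⟩ 0 0) :
    ¬ ∃ g : ℝ, 0 < g ∧ ∀ win, g ≤ bottomGapGauge d win :=
  fun ⟨_, hg0, hg⟩ => absurd h (not_le.2 (entry_neg_of_gauge_floor hg0 hg a ha))

/-- PROVED: an all-window positive datum admits no positive gauge floor. [folklore] -/
theorem AllWindowsPositive.not_exists_gauge_floor {d : Datum} (h : AllWindowsPositive d) :
    ¬ ∃ g : ℝ, 0 < g ∧ ∀ win, g ≤ bottomGapGauge d win :=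
  not_exists_gauge_floor_of_entry_nonneg (a := 1) (ha := one_pos)
    ((windowPositive_fin_one_iff (d ⟨1, 0, one_pos⟩)).1 (h ⟨1, 0, one_pos⟩))

/-- **PROVED (RH-free) — `ζ`'s degenerate entries are non-negative on Yoshida's short windows:**
`0 ≤ ζ ⟨a, 0⟩ 0 0` for `0 < a ≤ (log 2)/2` (Weil positivity there, `weilPositivityOn_of_le_log_two_half`, read as
`0 ≤ ε_ev(a)` and pushed up the Rayleigh–Ritz rung `ε_ev(a) ≤ ε₁(ζ(a, 0)) = ζ ⟨a, 0⟩ 0 0`). [folklore] -/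
theorem zeta_entry_N0_nonneg_of_le_log_two_half {a : ℝ} (ha : 0 < a) (hle : a ≤ Real.log 2 / 2) :
    0 ≤ zetaDatum ⟨a, 0, ha⟩ 0 0 := by
  have hW := weilPositivityOn_of_le_log_two_half hle
  have hE : 0 ≤ weilEvenGroundEnergy a :=
    (weilEvenGroundEnergy_nonneg_iff a).2 fun g hg hsupp _ => hW g hg hsupp
  have h1 : weilEvenGroundEnergy a ≤ bottomRayleigh (zetaDatum ⟨a, 0, ha⟩) :=
    weilEvenGroundEnergy_le_bottomRayleigh' ⟨a, 0, ha⟩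
  have h2 : bottomRayleigh (zetaDatum ⟨a, 0, ha⟩) = zetaDatum ⟨a, 0, ha⟩ 0 0 := bottomRayleigh_fin_one _
  linarith

/-- PROVED (RH-free): `ζ`'s bottom-gap gauge VANISHES at every degenerate short window. [folklore] -/
theorem zeta_bottomGapGauge_N0_eq_zero {a : ℝ} (ha : 0 < a) (hle : a ≤ Real.log 2 / 2) :
    bottomGapGauge zetaDatum ⟨a, 0, ha⟩ = 0 :=
  (gauge_fin_one_eq_zero_iff (zetaDatum ⟨a, 0, ha⟩)).2 (zeta_entry_N0_nonneg_of_le_log_two_half ha hle)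

/-- **PROVED (RH-free) — AT `ζ` THE FLOOR HYPOTHESIS OF `UniformlyRobustRelAt.uniformlyRobustAt` IS UNSATISFIABLE
for the bottom-gap gauge: there is no `g > 0` with `g ≤ bottomGapGauge ζ win` at every window.** [folklore] -/
theorem zeta_not_exists_gauge_floor : ¬ ∃ g : ℝ, 0 < g ∧ ∀ win, g ≤ bottomGapGauge zetaDatum win :=
  not_exists_gauge_floor_of_entry_nonneg
    (zeta_entry_N0_nonneg_of_le_log_two_half (div_pos (Real.log_pos one_lt_two) two_pos) le_rfl)

/-- **PROVED (RH-free) — THE UNGUARDED `τ_rel` DOOR IS TRIVIALLY OPEN: `⨅ win, bottomGapGauge ζ win = 0`**, attained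
at a degenerate short window; this is NOT the PF-N2 phenomenon the docstring of `PfPersistenceGapClassG1` §7 meant.
[folklore] -/
theorem zeta_iInf_bottomGapGauge_eq_zero : ⨅ win : Window, bottomGapGauge zetaDatum win = 0 := by
  haveI : Nonempty Window := ⟨⟨1, 0, one_pos⟩⟩
  have h2 : 0 < Real.log 2 / 2 := div_pos (Real.log_pos one_lt_two) two_pos
  apply le_antisymm
  · have hb : BddBelow (Set.range fun win : Window => bottomGapGauge zetaDatum win) :=
      ⟨0, by rintro _ ⟨win, rfl⟩; exact bottomGapGauge_nonneg' zetaDatum win⟩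
    exact (ciInf_le hb ⟨Real.log 2 / 2, 0, h2⟩).trans_eq (zeta_bottomGapGauge_N0_eq_zero h2 le_rfl)
  · exact le_ciInf fun win => bottomGapGauge_nonneg' zetaDatum win

/-- PROVED: where the gauge vanishes, UNGUARDED relative closeness PINS the window matrix. [folklore] -/
theorem UniformlyCloseRel.pins_N0 {γ : Window → ℝ} {ε : ℝ} {d₀ d : Datum} (h : UniformlyCloseRel γ ε d₀ d)
    {a : ℝ} {ha : 0 < a} (hγ : γ ⟨a, 0, ha⟩ = 0) : d ⟨a, 0, ha⟩ = d₀ ⟨a, 0, ha⟩ := by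
  refine fin_one_eq_of_form_sub_eq_zero (M := d₀ ⟨a, 0, ha⟩) (M' := d ⟨a, 0, ha⟩) fun v => ?_
  have h1 := h ⟨a, 0, ha⟩ v
  rw [hγ, mul_zero, zero_mul] at h1
  exact abs_nonpos_iff.1 h1

/-- **PROVED (RH-free): the unguarded `τ_rel(bottomGapGauge ζ)`-tube PINS every degenerate short window of `ζ`** —
a datum relatively close to `ζ` at any scale `ε` agrees with `ζ` at `⟨a, 0⟩`, `a ≤ (log 2)/2`. [folklore] -/
theorem uniformlyCloseRel_zetaGauge_pins_N0 {ε : ℝ} {d : Datum}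
    (h : UniformlyCloseRel (bottomGapGauge zetaDatum) ε zetaDatum d) {a : ℝ} (ha : 0 < a)
    (hle : a ≤ Real.log 2 / 2) : d ⟨a, 0, ha⟩ = zetaDatum ⟨a, 0, ha⟩ :=
  h.pins_N0 (zeta_bottomGapGauge_N0_eq_zero ha hle)

/-- PROVED: a floor `g` under `γ` on windows of dimension `≥ 2` is a floor `min g 1` EVERYWHERE under the
DIMENSION-GUARDED GAUGE `win ↦ if 0 < win.N then γ win else 1` (`γ` on windows of dimension `≥ 2`, the absolute unit
scale on degenerate windows, where a spectral-gap gauge is junk: RULING A324's guard applied to A22 R7). [folklore] -/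
theorem min_le_guardedGauge {γ : Window → ℝ} {g : ℝ} (hg : ∀ win : Window, 0 < win.N → g ≤ γ win) (win : Window) :
    min g 1 ≤ (if 0 < win.N then γ win else 1) := by
  split_ifs with hN
  · exact (min_le_left _ _).trans (hg win hN)
  · exact min_le_right _ _

/-- PROVED: a ceiling `G` over `γ` on windows of dimension `≥ 2` is a ceiling `max G 1` everywhere over the
dimension-guarded gauge. [folklore] -/
theorem guardedGauge_le_max {γ : Window → ℝ} {G : ℝ} (hG : ∀ win : Window, 0 < win.N → γ win ≤ G) (win : Window) :
    (if 0 < win.N then γ win else 1) ≤ max G 1 := by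
  split_ifs with hN
  · exact (hG win hN).trans (le_max_left _ _)
  · exact le_max_right _ _

/-- **PROVED — THE GUARDED BRIDGE TO W2** (replaces the unsatisfiable all-window floor of
`UniformlyRobustRelAt.uniformlyRobustAt`): `τ_rel`-robustness at `d₀` for the DIMENSION-GUARDED gauge plus a positive
floor under `γ` on windows of dimension `≥ 2` ONLY is `τ_unif`-robustness, so the uniform-modulus wall W2 applies;
the corrected `τ_rel` DOOR out of W2 is `inf over windows with 0 < N of γ = 0` (for `ζ`'s bottom gap: DATA, PF-N2 —
not the trivial all-window infimum `zeta_iInf_bottomGapGauge_eq_zero`). [folklore] -/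
theorem UniformlyRobustRelAt.uniformlyRobustAt_of_pos_floor {γ : Window → ℝ} {S : Set Datum} {d₀ : Datum}
    (h : UniformlyRobustRelAt (fun win => if 0 < win.N then γ win else 1) S d₀) {g : ℝ} (hg0 : 0 < g)
    (hg : ∀ win : Window, 0 < win.N → g ≤ γ win) : UniformlyRobustAt S d₀ :=
  h.uniformlyRobustAt (lt_min hg0 one_pos) (min_le_guardedGauge hg)

/-- PROVED: conversely a ceiling on windows of dimension `≥ 2` turns `τ_unif`-robustness into `τ_rel`-robustness
for the dimension-guarded gauge. [folklore] -/
theorem UniformlyRobustAt.uniformlyRobustRelAt_guarded {γ : Window → ℝ} {S : Set Datum} {d₀ : Datum}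
    (h : UniformlyRobustAt S d₀) {G : ℝ} (hG0 : 0 < G) (hG : ∀ win : Window, 0 < win.N → γ win ≤ G) :
    UniformlyRobustRelAt (fun win => if 0 < win.N then γ win else 1) S d₀ :=
  h.uniformlyRobustRelAt (hG0.trans_le (le_max_left G 1)) (guardedGauge_le_max hG)

/-- PROVED: with a two-sided bound `0 < g ≤ γ ≤ G` on windows of dimension `≥ 2`, guarded `τ_rel`-robustness and
`τ_unif`-robustness COINCIDE. [folklore] -/
theorem uniformlyRobustRelAt_guarded_iff {γ : Window → ℝ} {S : Set Datum} {d₀ : Datum} {g G : ℝ} (hg0 : 0 < g)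
    (hg : ∀ win : Window, 0 < win.N → g ≤ γ win) (hG : ∀ win : Window, 0 < win.N → γ win ≤ G) :
    UniformlyRobustRelAt (fun win => if 0 < win.N then γ win else 1) S d₀ ↔ UniformlyRobustAt S d₀ :=
  ⟨fun h => h.uniformlyRobustAt_of_pos_floor hg0 hg, fun h =>
    h.uniformlyRobustRelAt_guarded (hg0.trans_le ((hg ⟨1, 1, one_pos⟩ Nat.one_pos).trans (hG ⟨1, 1, one_pos⟩
      Nat.one_pos))) hG⟩

/-! ## §3 `N = 0`-safety on nested data: the dial space is decided on windows of dimension `≥ 2` -/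

/-- PROVED (every weight table): all-window positivity is decided on windows of dimension `≥ 2` — positivity at
`(a, 1)` restricts to the leading `1 × 1` corner `(a, 0)`. [folklore] -/
theorem allWindowsPositive_datumOf_iff_pos (w : Weights) :
    AllWindowsPositive (datumOf w) ↔ ∀ win : Window, 0 < win.N → WindowPositive (datumOf w win) := by
  refine ⟨fun h win _ => h win, fun h win => ?_⟩
  obtain ⟨a, N, ha⟩ := win
  rcases Nat.eq_zero_or_pos N with rfl | hN
  · exact F6.windowPositive_anti w ha (Nat.zero_le 1) (h ⟨a, 1, ha⟩ Nat.one_pos)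
  · exact h ⟨a, N, ha⟩ hN

/-- PROVED: the same for every datum of the dial space (`dialSpace = range datumOf ∋ ζ`). [folklore] -/
theorem allWindowsPositive_iff_pos_of_mem_dialSpace {d : Datum} (hd : d ∈ dialSpace) :
    AllWindowsPositive d ↔ ∀ win : Window, 0 < win.N → WindowPositive (d win) := by
  obtain ⟨w, rfl⟩ := hd
  exact allWindowsPositive_datumOf_iff_pos w

/-- PROVED (every weight table): detectable negativity is WITNESSED on a window of dimension `≥ 2` — a negative
degenerate entry zero-pads to a negative direction at `(a, 1)`. [folklore] -/
theorem detectablyNegative_datumOf_iff_pos (w : Weights) :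
    DetectablyNegative (datumOf w) ↔
      ∃ win : Window, 0 < win.N ∧ ∃ v : Fin (win.N + 1) → ℝ, v ⬝ᵥ (datumOf w win *ᵥ v) < 0 := by
  refine ⟨?_, fun ⟨win, _, v, hv⟩ => ⟨win, v, hv⟩⟩
  rintro ⟨⟨a, N, ha⟩, v, hv⟩
  rcases Nat.eq_zero_or_pos N with rfl | hN
  · obtain ⟨u, hu⟩ := F6.windowNegative_mono w ha (Nat.zero_le 1) ⟨v, hv⟩
    exact ⟨⟨a, 1, ha⟩, Nat.one_pos, u, hu⟩
  · exact ⟨⟨a, N, ha⟩, hN, v, hv⟩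

/-- PROVED: the same for every datum of the dial space. [folklore] -/
theorem detectablyNegative_iff_pos_of_mem_dialSpace {d : Datum} (hd : d ∈ dialSpace) :
    DetectablyNegative d ↔ ∃ win : Window, 0 < win.N ∧ ∃ v : Fin (win.N + 1) → ℝ, v ⬝ᵥ (d win *ᵥ v) < 0 := by
  obtain ⟨w, rfl⟩ := hd
  exact detectablyNegative_datumOf_iff_pos w

/-- PROVED (every weight table): height-floored positivity is decided on windows of dimension `≥ 2` — a Loewner
floor at `(a, 1)` compresses to the corner `(a, 0)`. [folklore] -/
theorem heightFlooredPositive_datumOf_iff_pos (w : Weights) :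
    HeightFlooredPositive (datumOf w) ↔ ∀ A : ℝ, ∃ m : ℝ, 0 < m ∧ ∀ win : Window, 0 < win.N → win.a ≤ A →
      ∀ v : Fin (win.N + 1) → ℝ, m * (v ⬝ᵥ v) ≤ v ⬝ᵥ (datumOf w win *ᵥ v) := by
  refine ⟨fun h A => ?_, fun h A => ?_⟩
  · obtain ⟨m, hm, hmw⟩ := h A
    exact ⟨m, hm, fun win _ hwin => hmw win hwin⟩
  · obtain ⟨m, hm, hmw⟩ := h A
    refine ⟨m, hm, fun win hwin => ?_⟩
    obtain ⟨a, N, ha⟩ := win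
    rcases Nat.eq_zero_or_pos N with rfl | hN
    · exact F6.galerkin_floor_mono w ha (Nat.zero_le 1) m (hmw ⟨a, 1, ha⟩ Nat.one_pos hwin)
    · exact hmw ⟨a, N, ha⟩ hN hwin

/-- PROVED: the same for every datum of the dial space. [folklore] -/
theorem heightFlooredPositive_iff_pos_of_mem_dialSpace {d : Datum} (hd : d ∈ dialSpace) :
    HeightFlooredPositive d ↔ ∀ A : ℝ, ∃ m : ℝ, 0 < m ∧ ∀ win : Window, 0 < win.N → win.a ≤ A →
      ∀ v : Fin (win.N + 1) → ℝ, m * (v ⬝ᵥ v) ≤ v ⬝ᵥ (d win *ᵥ v) := by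
  obtain ⟨w, rfl⟩ := hd
  exact heightFlooredPositive_datumOf_iff_pos w

/-- PROVED (every pair of weight tables): zero-padding preserves the form of the DIFFERENCE of two nested data.
[folklore] -/
theorem form_sub_snoc_zero (w w' : Weights) (a : ℝ) (ha : 0 < a) (N : ℕ) (v : Fin (N + 1) → ℝ) :
    (Fin.snoc v 0 : Fin (N + 1 + 1) → ℝ) ⬝ᵥ ((datumOf w ⟨a, N + 1, ha⟩ - datumOf w' ⟨a, N + 1, ha⟩) *ᵥ
        (Fin.snoc v 0 : Fin (N + 1 + 1) → ℝ)) = v ⬝ᵥ ((datumOf w ⟨a, N, ha⟩ - datumOf w' ⟨a, N, ha⟩) *ᵥ v) := by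
  rw [Matrix.sub_mulVec, dotProduct_sub, datumOf_form_snoc_zero, datumOf_form_snoc_zero, Matrix.sub_mulVec,
    dotProduct_sub]

/-- PROVED (every pair of weight tables): `ε`-form-closeness at `(a, N + 1)` restricts to `(a, N)`. [folklore] -/
theorem formClose_of_succ (w w' : Weights) (a : ℝ) (ha : 0 < a) (N : ℕ) {ε : ℝ}
    (h : ∀ u : Fin (N + 1 + 1) → ℝ,
      |u ⬝ᵥ ((datumOf w ⟨a, N + 1, ha⟩ - datumOf w' ⟨a, N + 1, ha⟩) *ᵥ u)| ≤ ε * (u ⬝ᵥ u))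
    (v : Fin (N + 1) → ℝ) : |v ⬝ᵥ ((datumOf w ⟨a, N, ha⟩ - datumOf w' ⟨a, N, ha⟩) *ᵥ v)| ≤ ε * (v ⬝ᵥ v) := by
  have h1 := h (Fin.snoc v 0)
  rwa [form_sub_snoc_zero, snoc_zero_dotProduct] at h1

/-- **PROVED — THE TUBE TOPOLOGY ON THE DIAL SPACE IGNORES DEGENERATE WINDOWS:** `τ_unif`-closeness of two nested
data is decided on windows of dimension `≥ 2`. [folklore] -/
theorem uniformlyClose_datumOf_iff_pos (ε : ℝ) (w w' : Weights) :
    UniformlyClose ε (datumOf w) (datumOf w') ↔ ∀ win : Window, 0 < win.N →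
      ∀ v : Fin (win.N + 1) → ℝ, |v ⬝ᵥ ((datumOf w win - datumOf w' win) *ᵥ v)| ≤ ε * (v ⬝ᵥ v) := by
  refine ⟨fun h win _ => h win, fun h win => ?_⟩
  obtain ⟨a, N, ha⟩ := win
  rcases Nat.eq_zero_or_pos N with rfl | hN
  · exact formClose_of_succ w w' a ha 0 (h ⟨a, 0 + 1, ha⟩ Nat.one_pos)
  · exact h ⟨a, N, ha⟩ hN

/-- PROVED: the same for every pair of data of the dial space. [folklore] -/
theorem uniformlyClose_iff_pos_of_mem_dialSpace {ε : ℝ} {d d' : Datum} (hd : d ∈ dialSpace) (hd' : d' ∈ dialSpace) :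
    UniformlyClose ε d d' ↔ ∀ win : Window, 0 < win.N →
      ∀ v : Fin (win.N + 1) → ℝ, |v ⬝ᵥ ((d win - d' win) *ᵥ v)| ≤ ε * (v ⬝ᵥ v) := by
  obtain ⟨w, rfl⟩ := hd
  obtain ⟨w', rfl⟩ := hd'
  exact uniformlyClose_datumOf_iff_pos ε w w'

/-- **PROVED — SUMMARY (N = 0-SAFETY OF THE EXISTENCE TABLE ON THE DIAL SPACE):** for `d ∈ dialSpace` the three
existence-table predicates are equivalent to their restrictions to windows of dimension `≥ 2`, bundled. [folklore] -/
theorem existenceTable_N0_safe {d : Datum} (hd : d ∈ dialSpace) :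
    (AllWindowsPositive d ↔ ∀ win : Window, 0 < win.N → WindowPositive (d win)) ∧
    (DetectablyNegative d ↔ ∃ win : Window, 0 < win.N ∧ ∃ v : Fin (win.N + 1) → ℝ, v ⬝ᵥ (d win *ᵥ v) < 0) ∧
    (HeightFlooredPositive d ↔ ∀ A : ℝ, ∃ m : ℝ, 0 < m ∧ ∀ win : Window, 0 < win.N → win.a ≤ A →
      ∀ v : Fin (win.N + 1) → ℝ, m * (v ⬝ᵥ v) ≤ v ⬝ᵥ (d win *ᵥ v)) :=
  ⟨allWindowsPositive_iff_pos_of_mem_dialSpace hd, detectablyNegative_iff_pos_of_mem_dialSpace hd,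
    heightFlooredPositive_iff_pos_of_mem_dialSpace hd⟩

end Summit.RiemannHypothesis.RiemannHypothesis.Theorems.PfPersistence

end
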